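import Summits.KontsevichZagierPeriods.KontsevichZagierPeriods.Theorems.SymplecticScissorsRealOnePeriodRelationsAlgRatLayer
import Summits.KontsevichZagierPeriods.KontsevichZagierPeriods.Theorems.SymplecticScissorsRealOnePeriodRelationsStubEulerLeadCell
import Summits.KontsevichZagierPeriods.KontsevichZagierPeriods.Theorems.SymplecticScissorsRealOnePeriodRelationsStubEulerRootCell
import Summits.KontsevichZagierPeriods.KontsevichZagierPeriods.Theorems.SymplecticScissorsRealOnePeriodRelationsStubHomotopyInvarianceAux

/-!
# `RealOnePeriodRelations` (stmt-KontsevichZagierPeriods-10042), line `nash-retraction-thin-strip`, reshape 9b: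
# the CONIC layer of the crux — Euler's substitutions — unconditionally

Periods of real CONICS in Kontsevich–Zagier's clothes: `∫_a^b P(x) dx/(Q(x)√q(x))` with a real algebraic quadratic `q` positive on
`[a, b]` (`π = 6∫_0^{1/2} dx/√(1 − x²)`, inverse trigonometric and logarithmic values at algebraic points).  Each such representation is
ONE instance of rule (2) away from a rational representation with real algebraic coefficients — Euler's first substitution
`√q = t + √α x` when the leading coefficient `α` is positive (`stub_eulerLeadCell`), Euler's third substitution `√q = t(x − ρ)` through
a real root when `α < 0` (`stub_eulerRootCell`) — so the genus-0 layer in algebraic clothes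
(`ConicLayer.realOnePeriodRelations_algRatLayer`) applies.

* `realOnePeriodRelations_conicLayer` — every `ℤ`-relation with value `0` among literal rational representations, algebraic-rational
  representations and conic representations lies in `M₁ = closure (1a ∪ 1b ∪ 2 ∪ Green)` — unconditionally.

References: M. Kontsevich, D. Zagier, *Periods* (2001), §1.1 (the example `π`), §1.2 (rule 2); A. Huber, G. Wüstholz, *Transcendence
and Linear Relations of 1-Periods* (CUP 2022), Thm 13.3 (2).
-/

noncomputable section

open scoped BigOperators Polynomial
open Set MeasureTheory MvPolynomial
open Literature.NumberTheory.Transcendental Literature.NumberTheory.Transcendental.CurvePeriods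
open Summit.KontsevichZagierPeriods.SymplecticScissors.RealOnePeriodRelationsNegative (M₁ H₁)

namespace Summit.KontsevichZagierPeriods.SymplecticScissors.RealOnePeriodRelations

namespace ConicLayer

/-- **THE CONIC LAYER, UNCONDITIONALLY (Euler's substitutions).**  Every `ℤ`-combination with vanishing value of literal rational
representations, algebraic-rational representations `∫_a^b P/Q`, and representations `∫_a^b P/(Q√q)` with a real algebraic quadratic
`q` positive on `[a, b]` (`α > 0` with non-zero discriminant, or `α < 0` with `[a, b]` between the real roots) — the periods of real
CONICS: `π = 6∫_0^{1/2} dx/√(1 − x²)`, logarithms, inverse trigonometric values at algebraic points — lies in `M₁`.  Proof: each conic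
generator is ONE instance of rule (2) away from an algebraic-rational representation (`stub_eulerLeadCell`, `stub_eulerRootCell`), and
`realOnePeriodRelations_algRatLayer` applies. [cite: KontsevichZagier2001, §1.1 (the example `π`), §1.2 (rule 2)] [cite: HuberWustholz2022, Thm 13.3 (2)] -/
theorem realOnePeriodRelations_conicLayer : ∀ c : KZ.FormalRep,
    c ∈ AddSubgroup.closure ((fun r : KZ.IntegralRep 1 => KZ.of r) ''
      {r | r.IsRational ∨
        (∃ a b : ℝ, IsAlgebraic ℚ a ∧ IsAlgebraic ℚ b ∧ a < b ∧ r.domain = {z | z 0 ∈ Set.Ioo a b} ∧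
          ∃ P Q : Polynomial (algebraicClosure ℚ ℝ), (∀ x ∈ Set.Ioo a b, Polynomial.aeval x Q ≠ 0) ∧
            ∀ x ∈ Set.Ioo a b, r.integrand (fun _ => x) = Polynomial.aeval x P / Polynomial.aeval x Q) ∨
        (∃ α β γ a b : ℝ, IsAlgebraic ℚ α ∧ IsAlgebraic ℚ β ∧ IsAlgebraic ℚ γ ∧ IsAlgebraic ℚ a ∧ IsAlgebraic ℚ b ∧ a < b ∧
          0 < α ∧ β ^ 2 - 4 * α * γ ≠ 0 ∧ (∀ x ∈ Set.Icc a b, 0 < α * x ^ 2 + β * x + γ) ∧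
          r.domain = {z | z 0 ∈ Set.Ioo a b} ∧
          ∃ P Q : Polynomial (algebraicClosure ℚ ℝ), (∀ x ∈ Set.Icc a b, Polynomial.aeval x Q ≠ 0) ∧
            ∀ z ∈ r.domain, r.integrand z =
              Polynomial.aeval (z 0) P / (Polynomial.aeval (z 0) Q * Real.sqrt (α * (z 0) ^ 2 + β * (z 0) + γ))) ∨
        (∃ α ρ ρ' a b : ℝ, IsAlgebraic ℚ α ∧ IsAlgebraic ℚ ρ ∧ IsAlgebraic ℚ ρ' ∧ IsAlgebraic ℚ a ∧ IsAlgebraic ℚ b ∧ a < b ∧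
          α < 0 ∧ ρ < a ∧ b < ρ' ∧ r.domain = {z | z 0 ∈ Set.Ioo a b} ∧
          ∃ P Q : Polynomial (algebraicClosure ℚ ℝ), (∀ x ∈ Set.Icc a b, Polynomial.aeval x Q ≠ 0) ∧
            ∀ z ∈ r.domain, r.integrand z =
              Polynomial.aeval (z 0) P / (Polynomial.aeval (z 0) Q * Real.sqrt (α * ((z 0) - ρ) * ((z 0) - ρ'))))}) →
    KZ.eval c = 0 →
    c ∈ AddSubgroup.closure (KZ.domainAddRel ∪ KZ.integrandAddRel ∪ KZ.changeOfVariablesRel ∪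
      {g : KZ.FormalRep | ∃ (Δ : Set (Fin 2 → ℝ)) (A B S : (Fin 2 → ℝ) → ℝ) (r₀₁ r₁₂ r₀₂ : KZ.IntegralRep 1),
        Δ = {p | 0 ≤ p 0 ∧ 0 ≤ p 1 ∧ p 0 + p 1 ≤ 1} ∧ IsSemialgebraicFunOn ℚ Δ A ∧ IsSemialgebraicFunOn ℚ Δ B ∧
        ContinuousOn A Δ ∧ ContinuousOn B Δ ∧
        (∀ p : Fin 2 → ℝ, 0 < p 0 → 0 < p 1 → p 0 + p 1 < 1 →
          HasFDerivAt S (A p • ContinuousLinearMap.proj (R := ℝ) (φ := fun _ : Fin 2 => ℝ) 0 +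
            B p • ContinuousLinearMap.proj (R := ℝ) (φ := fun _ : Fin 2 => ℝ) 1) p) ∧
        r₀₁.domain = {z | z 0 ∈ Set.Ioo 0 1} ∧ r₁₂.domain = {z | z 0 ∈ Set.Ioo 0 1} ∧
        r₀₂.domain = {z | z 0 ∈ Set.Ioo 0 1} ∧ (∀ z ∈ r₀₁.domain, r₀₁.integrand z = A ![z 0, 0]) ∧
        (∀ z ∈ r₁₂.domain, r₁₂.integrand z = B ![1 - z 0, z 0] - A ![1 - z 0, z 0]) ∧
        (∀ z ∈ r₀₂.domain, r₀₂.integrand z = B ![0, z 0]) ∧ g = KZ.of r₀₁ + KZ.of r₁₂ - KZ.of r₀₂}) := by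
  intro c hc heval
  change c ∈ M₁
  -- every generator is, modulo `M₁`, a generator of the algebraic-rational layer
  have key : ∀ c : KZ.FormalRep, c ∈ AddSubgroup.closure ((fun r : KZ.IntegralRep 1 => KZ.of r) ''
      {r | r.IsRational ∨
        (∃ a b : ℝ, IsAlgebraic ℚ a ∧ IsAlgebraic ℚ b ∧ a < b ∧ r.domain = {z | z 0 ∈ Set.Ioo a b} ∧
          ∃ P Q : Polynomial (algebraicClosure ℚ ℝ), (∀ x ∈ Set.Ioo a b, Polynomial.aeval x Q ≠ 0) ∧
            ∀ x ∈ Set.Ioo a b, r.integrand (fun _ => x) = Polynomial.aeval x P / Polynomial.aeval x Q) ∨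
        (∃ α β γ a b : ℝ, IsAlgebraic ℚ α ∧ IsAlgebraic ℚ β ∧ IsAlgebraic ℚ γ ∧ IsAlgebraic ℚ a ∧ IsAlgebraic ℚ b ∧ a < b ∧
          0 < α ∧ β ^ 2 - 4 * α * γ ≠ 0 ∧ (∀ x ∈ Set.Icc a b, 0 < α * x ^ 2 + β * x + γ) ∧
          r.domain = {z | z 0 ∈ Set.Ioo a b} ∧
          ∃ P Q : Polynomial (algebraicClosure ℚ ℝ), (∀ x ∈ Set.Icc a b, Polynomial.aeval x Q ≠ 0) ∧
            ∀ z ∈ r.domain, r.integrand z =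
              Polynomial.aeval (z 0) P / (Polynomial.aeval (z 0) Q * Real.sqrt (α * (z 0) ^ 2 + β * (z 0) + γ))) ∨
        (∃ α ρ ρ' a b : ℝ, IsAlgebraic ℚ α ∧ IsAlgebraic ℚ ρ ∧ IsAlgebraic ℚ ρ' ∧ IsAlgebraic ℚ a ∧ IsAlgebraic ℚ b ∧ a < b ∧
          α < 0 ∧ ρ < a ∧ b < ρ' ∧ r.domain = {z | z 0 ∈ Set.Ioo a b} ∧
          ∃ P Q : Polynomial (algebraicClosure ℚ ℝ), (∀ x ∈ Set.Icc a b, Polynomial.aeval x Q ≠ 0) ∧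
            ∀ z ∈ r.domain, r.integrand z =
              Polynomial.aeval (z 0) P / (Polynomial.aeval (z 0) Q * Real.sqrt (α * ((z 0) - ρ) * ((z 0) - ρ'))))}) →
      ∃ c' : KZ.FormalRep, c' ∈ AddSubgroup.closure ((fun r : KZ.IntegralRep 1 => KZ.of r) ''
      {r | r.IsRational ∨
        (∃ a b : ℝ, IsAlgebraic ℚ a ∧ IsAlgebraic ℚ b ∧ a < b ∧ r.domain = {z | z 0 ∈ Set.Ioo a b} ∧
          ∃ P Q : Polynomial (algebraicClosure ℚ ℝ), (∀ x ∈ Set.Ioo a b, Polynomial.aeval x Q ≠ 0) ∧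
            ∀ x ∈ Set.Ioo a b, r.integrand (fun _ => x) = Polynomial.aeval x P / Polynomial.aeval x Q)}) ∧
      c - c' ∈ M₁ := by
    intro c hc
    refine AddSubgroup.closure_induction (p := fun c _ => ∃ c' : KZ.FormalRep, c' ∈ _ ∧ c - c' ∈ M₁) ?_ ?_ ?_ ?_ hc
    · rintro _ ⟨r, hr, rfl⟩
      rcases hr with hrat | halg | ⟨α, β, γ, a, b, hα, hβ, hγ, ha, hb, hab, hα0, hdisc, hpos, hdom, P, Q, hQ, hint⟩ |
        ⟨α, ρ, ρ', a, b, hα, hρ, hρ', ha, hb, hab, hα0, hρa, hbρ', hdom, P, Q, hQ, hint⟩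
      · exact ⟨KZ.of r, AddSubgroup.subset_closure ⟨r, Or.inl hrat, rfl⟩, by rw [sub_self]; exact M₁.zero_mem⟩
      · exact ⟨KZ.of r, AddSubgroup.subset_closure ⟨r, Or.inr halg, rfl⟩, by rw [sub_self]; exact M₁.zero_mem⟩
      · obtain ⟨r', ⟨a', b', ha', hb', hab', hdom', P', Q', hQ', hint'⟩, hrel⟩ :=
          stub_eulerLeadCell α β γ a b hα hβ hγ ha hb hab hα0 hdisc hpos P Q hQ r hdom hint
        exact ⟨KZ.of r', AddSubgroup.subset_closure ⟨r', Or.inr ⟨a', b', ha', hb', hab', hdom', P', Q', hQ', hint'⟩, rfl⟩,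
          HomotopyInvariance.changeOfVariablesRel_subset hrel⟩
      · obtain ⟨r', ⟨a', b', ha', hb', hab', hdom', P', Q', hQ', hint'⟩, hrel⟩ :=
          stub_eulerRootCell α ρ ρ' a b hα hρ hρ' ha hb hab hα0 hρa hbρ' P Q hQ r hdom hint
        exact ⟨KZ.of r', AddSubgroup.subset_closure ⟨r', Or.inr ⟨a', b', ha', hb', hab', hdom', P', Q', hQ', hint'⟩, rfl⟩,
          HomotopyInvariance.changeOfVariablesRel_subset hrel⟩
    · exact ⟨0, AddSubgroup.zero_mem _, by rw [sub_self]; exact M₁.zero_mem⟩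
    · rintro c₁ c₂ _ _ ⟨c₁', h₁', h₁⟩ ⟨c₂', h₂', h₂⟩
      refine ⟨c₁' + c₂', AddSubgroup.add_mem _ h₁' h₂', ?_⟩
      have e : c₁ + c₂ - (c₁' + c₂') = (c₁ - c₁') + (c₂ - c₂') := by abel
      rw [e]
      exact M₁.add_mem h₁ h₂
    · rintro c₁ _ ⟨c₁', h₁', h₁⟩
      refine ⟨-c₁', AddSubgroup.neg_mem _ h₁', ?_⟩
      have e : -c₁ - -c₁' = -(c₁ - c₁') := by abel
      rw [e]
      exact M₁.neg_mem h₁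
  obtain ⟨c', hc', hcc'⟩ := key c hc
  have heval' : KZ.eval c' = 0 := by
    have h := Summit.KontsevichZagierPeriods.SymplecticScissors.RealOnePeriodRelationsNegative.eval_eq_zero_of_mem_M₁ hcc'
    rw [map_sub, heval, zero_sub, neg_eq_zero] at h
    exact h
  have hM : c' ∈ M₁ := realOnePeriodRelations_algRatLayer c' hc' heval'
  have e : c = (c - c') + c' := by abel
  rw [e]
  exact M₁.add_mem hcc' hM


end ConicLayer

end Summit.KontsevichZagierPeriods.SymplecticScissors.RealOnePeriodRelations

end
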